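import Literature.NumberTheory.EllipticCurves.Rank1Residual.X10RankZeroIntegralMainConjecture
import Literature.NumberTheory.EllipticCurves.BurungaleSkinnerTianWan2024.OrdinaryMainStatementSemistableOPEN
import HarnessLib

/-!
# Rank `0` at a good ordinary `p ≥ 3` for SEMISTABLE curves with `E[p]` irreducible and NO ramified
# multiplicative prime: the PREPRINT road through Burungale–Skinner–Tian–Wan Thm. 10.10 (a)
# (cell `b2b-bsdres` X10 lane × typing layer `bsd-littype-01`; PROOFS ONLY)

HONEST FRAMING (run/shared/lean/b2b/bsd-rank1-residual/, verbatim): the goal of the cell is to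
DELETE the COMBINATION-SHAPED residual classes for ALL analytic-rank `≤ 1` elliptic curves over `ℚ`
— "full BSD formula for every rank `≤ 1` curve in class C" assembled STRICTLY from published
theorems — so that the rank-`≤ 1` remainder becomes exactly the CONSTRUCTION-SHAPED classes, which
are TYPED (missing-input `Prop`s), NOT attempted. This is not "finishing BSD". Typed ≠ proved ≠
endorsed: the input below is an UNREFEREED PREPRINT binder (PRE), never a theorem.

`X10RankZeroIntegralMainConjecture.lean` (`X10.bsdp_three_rankZero_of_integralMainConjecture`) showed:
on X10 ∧ r = 0 (`p = 3` good ordinary, `E[3]` irreducible, `¬ram(3)`) an INTEGRAL cyclotomic main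
conj. at `(E, 3)` suffices for Miller's `BSD(E, 3)` (Castella–Grossi–Lee–Skinner 2022 proof of
Thm. 5.1.4 = `padicValRat_bsd_rank_zero_of_mazurMainConjecture` + Greenberg LNM 1716 Thm. 4.1 +
modularity + GZK), the integral main conj. being, there, "Yan–Zhu 2026 Thm. 4.9 [PUB\*, flag
`YZ26@3-BF-ERL-Ohta`] on X10a′, the typed missing object on X10b". The typing layer has now typed
(p498286, `BurungaleSkinnerTianWan2024/OrdinaryMainStatementSemistableOPEN.lean`) the preprint
statement that supplies that integral main conj. at `p = 3` for SEMISTABLE curves under (irr_ℚ) alone —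
Burungale–Skinner–Tian–Wan arXiv:2409.01350v2 Thm. 10.10 (a) ("`N` square-free, `p ∤ 2N` ordinary,
(irr_ℚ) ⟹ Conj. 9.3", i.e. Mazur's statement integrally; Rem. 10.11: "a different proof of a special
case of Theorem 9.21 (c)"; NOT the Skinner–Urban road: no (ram); NOT BCS25 1.1.2 (b): `p = 3` and no
(im)) as the OPEN binder `thm1010a_mainStatement_semistable_ordinary_OPEN`, whose conclusion
`CharIdealEqPadicLFunctionNeron W p` is LITERALLY the hypothesis `hMC` of
`padicValRat_bsd_rank_zero_of_mazurMainConjecture` (Néron normalisation — no period-unit side input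
`hϖ` is needed, unlike the `f`-normalised `hIMC` of the sibling file). This file records the
composition:

* `bsdp_rankZero_of_thm1010a_OPEN` — any `p ≠ 2`: `Semistable W`, good ordinary at `p`, `E[p]`
  irreducible, `ord_{s=1} L(E,s) = 0` ⟹ `BSDp W p`, granted the binder (PRE) + Greenberg Thm. 4.1
  (`greenberg_charValue_rankZero`) + modularity (`nonempty_modularParametrizationData`) + GZK;
* `X10.bsdp_three_rankZero_semistable_of_thm1010a_OPEN`, `X10.missingInputAt_rankZero_semistable_of_thm1010a_OPEN`
  — the X10 ∧ r = 0 ∧ SEMISTABLE sub-cell (either mod-`3` image: X10a′ and X10b alike) is closed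
  MODULO ONE PREPRINT BINDER; which X10 ∧ r = 0 pairs are semistable is the census engines' call.

Nothing here is a verdict: the binder is priced PRE by the referee desks, exactly as the YZ26@3 road
is priced PUB\*. Theorems only (kernel lane).

References: [BurungaleSkinnerTianWan2024] Thm. 10.10 (a), Rem. 10.11 (p. 89); [CastellaEtAl2021]
Thm. 5.1.4 (proof); [GreenbergLNM1716] Thm. 4.1; [Miller2011LMS] Def. 1.1; X10-AUDIT.md §11.
-/

set_option autoImplicit false

noncomputable section

open scoped Classical

open WeierstrassCurve Literature.NumberTheory.EllipticCurves
  Literature.NumberTheory.EllipticCurves.ModularForms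
  Literature.NumberTheory.EllipticCurves.BurungaleSkinnerTianWan2024

namespace Literature.NumberTheory.EllipticCurves.Rank1Residual

/-- **Rank `0`, semistable, good ordinary `p ≠ 2`, `E[p]` irreducible: `BSD(E,p)` modulo the PREPRINT
binder BSTW Thm. 10.10 (a)** (`hBSTW_OPEN`, NEVER a theorem) and the REFEREED Greenberg LNM 1716
Thm. 4.1 (`hGr`), modularity with integral Manin constant (`hmod`), Gross–Zagier–Kolyvagin (`hGZK`):
the binder's conclusion `CharIdealEqPadicLFunctionNeron W p` is verbatim the Mazur-main-conj.
hypothesis of `padicValRat_bsd_rank_zero_of_mazurMainConjecture` (CGLS 2022, proof of Thm. 5.1.4),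
and `bsdp_of_padicValRat_rank_zero` converts the print shape to Miller's `BSDp`. No (ram), no (im),
`p = 3` allowed. CONDITIONAL on the OPEN binder. [claim: BurungaleSkinnerTianWan2024, status: under-review]
[cite: BurungaleSkinnerTianWan2024, Thm. 10.10 (a) (p. 89; label IMC_ord; OPEN binder)]
[cite: CastellaEtAl2021, Thm. 5.1.4 and its proof (§5.1.3)] [cite: GreenbergLNM1716, Thm. 4.1 (p. 102)]
[cite: Miller2011LMS, Def. 1.1 (arXiv:1010.2431 p. 3)] -/
theorem bsdp_rankZero_of_thm1010a_OPEN
    (hBSTW_OPEN : thm1010a_mainStatement_semistable_ordinary_OPEN)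
    (hGr : greenberg_charValue_rankZero) (hmod : nonempty_modularParametrizationData)
    (hGZK : rank_eq_analyticRank_of_analyticRank_le_one)
    (W : WeierstrassCurve ℚ) [W.IsElliptic] [W.IsGloballyMinimal] (p : ℕ) [Fact p.Prime]
    (hp2 : p ≠ 2) (hsst : Semistable W) (hgood : W.HasGoodReductionAtPrime p)
    (hord : ¬ (p : ℤ) ∣ W.frobeniusTrace p) (hirr : W.HasIrreducibleModPGaloisRep p)
    (hr0 : W.analyticRank = 0) : BSDp W p := by
  haveI : NeZero (W.conductorNorm ℤ) := ⟨(W.conductorNorm_pos_holds).ne'⟩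
  obtain ⟨Dm⟩ := hmod W
  have hL : W.entireLFunction 1 ≠ 0 :=
    (W.analyticRank_eq_zero_iff_holds Dm.isNewformOf.hasEntireLFunction).mp hr0
  have hfin : Finite W.sha := (hGZK W (by rw [hr0]; exact zero_le_one)).2
  exact bsdp_of_padicValRat_rank_zero W p hr0 hL hGZK
    (padicValRat_bsd_rank_zero_of_mazurMainConjecture W p hgood hord hL hfin hmod
      (hGr W p hp2 hgood hord) (hBSTW_OPEN W p hp2 hsst hgood hord hirr))

/-- **X10 ∧ r = 0 ∧ SEMISTABLE (either mod-`3` image): `BSD(E,3)` modulo the PREPRINT binder BSTW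
Thm. 10.10 (a)** + Greenberg Thm. 4.1 + modularity + GZK. The class supplies `p = 3` good ordinary and
`E[3]` irreducible (`ClassX10 W 3`); `Semistable W` is the extra per-curve condition (decided by the
census engines); `¬ram(3)` is NOT needed (unlike the Skinner–Urban road) and neither is `surj(3)`
(unlike Kato's integral clause). CONDITIONAL on the OPEN binder; no class is relabelled here.
[claim: BurungaleSkinnerTianWan2024, status: under-review]
[cite: BurungaleSkinnerTianWan2024, Thm. 10.10 (a) (p. 89; OPEN binder)] [cite: Miller2011LMS, Def. 1.1] -/
theorem X10.bsdp_three_rankZero_semistable_of_thm1010a_OPEN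
    (hBSTW_OPEN : thm1010a_mainStatement_semistable_ordinary_OPEN)
    (hGr : greenberg_charValue_rankZero) (hmod : nonempty_modularParametrizationData)
    (hGZK : rank_eq_analyticRank_of_analyticRank_le_one)
    (W : WeierstrassCurve ℚ) [W.IsElliptic] [W.IsGloballyMinimal]
    (hX : ClassX10 W 3) (hsst : Semistable W) (hr0 : W.analyticRank = 0) : BSDp W 3 :=
  bsdp_rankZero_of_thm1010a_OPEN hBSTW_OPEN hGr hmod hGZK W 3 (by decide) hsst hX.2.1.1 hX.2.1.2
    hX.2.2.1 hr0

/-- **Hence the typed missing input `Typed.X10.MissingInputAt W` is discharged on X10 ∧ r = 0 ∧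
SEMISTABLE modulo the PREPRINT binder** (bookkeeping, as in the sibling file's
`X10.missingInputAt_rankZero_of_integralMainConjecture`). CONDITIONAL; no verdict.
[claim: BurungaleSkinnerTianWan2024, status: under-review]
[cite: BurungaleSkinnerTianWan2024, Thm. 10.10 (a) (p. 89; OPEN binder)] [cite: Miller2011LMS, Def. 1.1] -/
theorem X10.missingInputAt_rankZero_semistable_of_thm1010a_OPEN
    (hBSTW_OPEN : thm1010a_mainStatement_semistable_ordinary_OPEN)
    (hGr : greenberg_charValue_rankZero) (hmod : nonempty_modularParametrizationData)
    (hGZK : rank_eq_analyticRank_of_analyticRank_le_one)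
    (W : WeierstrassCurve ℚ) [W.IsElliptic] [W.IsGloballyMinimal]
    (hX : ClassX10 W 3) (hsst : Semistable W) (hr0 : W.analyticRank = 0) :
    Typed.X10.MissingInputAt W := by
  haveI : Finite W.sha := (hGZK W hX.analyticRank_le_one).2
  exact Typed.X10.missingInputAt_of_bsdp W
    (X10.bsdp_three_rankZero_semistable_of_thm1010a_OPEN hBSTW_OPEN hGr hmod hGZK W hX hsst hr0)

end Literature.NumberTheory.EllipticCurves.Rank1Residual

end
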